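import Literature.Geometry.Symplectic.JHolomorphicMap
import Literature.Geometry.Symplectic.JHolomorphicUniqueContinuationFlat
import Mathlib.Geometry.Manifold.MFDeriv.Atlas
import Mathlib.Geometry.Manifold.MFDeriv.Tangent
import Mathlib.Geometry.Manifold.ContMDiff.Atlas
import Mathlib.Geometry.Manifold.ContMDiff.NormedSpace
import Mathlib.Geometry.Manifold.Instances.Real
import Mathlib.Topology.Connected.Clopen

/-!
# McDuff's unique continuation lemma for `J`-holomorphic curves: the chart reduction

This file contains the closedness step `JHolomorphicUCP.eventuallyEq_of_mem_closure` of the proof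
of the named fact `Literature.Geometry.Symplectic.jHolomorphic_uniqueContinuation_const`
(McDuff, JDG 34 (1991), Lemma 2.3 p. 147, special case: a smooth `J`-holomorphic `G : ℂ → V`
into a smooth almost complex `4`-manifold which is constant near one point is constant); the
fact itself is discharged in `JHolomorphicLocalIntersectionsProofs.lean`
(`jHolomorphic_uniqueContinuation_const_holds`).

Proof. The set `A = {z | G = G z₀ near z}` is open and contains `z₀`; since `ℂ` is connected it
suffices to show that `A` is closed. At `z₁ ∈ closure A` we have
`G z₁ = p := G z₀`; in the chart `extChartAt p` the map `u = extChartAt p ∘ G` is smooth near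
`z₁` and satisfies `∂_y u = Jt z (∂ₓ u)` with
`Jt z = inTangentCoordinates I I id id J p (G z) = D(chart) ∘ J (G z) ∘ D(chart⁻¹)`
(`inTangentCoordinates_eq_mfderiv_comp`, `mfderiv_comp`,
`mfderivWithin_extChartAt_symm_comp_mfderiv_extChartAt'`), a `C²` family of complex structures
(the smoothness hypothesis on `J`). The flat unique continuation theorem
`JHolomorphicUCP.eventuallyEq_const_of_jHolomorphicFlat` (Carleman's method, files
`Literature/Analysis/PDE/DbarCarlemanEstimate.lean`, `…/DbarWeakUniqueContinuation.lean`,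
`Literature/Geometry/Symplectic/JHolomorphicUniqueContinuationFlat.lean`) gives `u = u z₁`
near `z₁`, hence `G = p` near `z₁` by injectivity of the chart.
-/

noncomputable section

open scoped Manifold ContDiff Topology
open Set Filter Function

namespace Literature.Geometry.Symplectic

namespace JHolomorphicUCP

/-- **Closedness step.** In the setting of `jHolomorphic_uniqueContinuation_const`, if `z₁` is in
the closure of the open set where `G` is locally equal to `p`, then `G` is locally equal to `p`
at `z₁` (chart reduction + `eventuallyEq_const_of_jHolomorphicFlat`).
[cite: McDuff1991LocalBehaviour, Lemma 2.3] -/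
theorem eventuallyEq_of_mem_closure (V : Type) [TopologicalSpace V] [T2Space V]
    [ChartedSpace (EuclideanSpace ℝ (Fin 4)) V] [IsManifold (𝓡 4) ∞ V]
    (J : ∀ x : V, TangentSpace (𝓡 4) x →L[ℝ] TangentSpace (𝓡 4) x)
    (hJ2 : ∀ (x : V) (v : TangentSpace (𝓡 4) x), J x (J x v) = -v)
    (hJs : ∀ x₀ : V, ContMDiffAt (𝓡 4)
      𝓘(ℝ, EuclideanSpace ℝ (Fin 4) →L[ℝ] EuclideanSpace ℝ (Fin 4)) ∞
      (inTangentCoordinates (𝓡 4) (𝓡 4) (id : V → V) id (fun x => J x) x₀) x₀)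
    (G : ℂ → V) (hG : ContMDiff 𝓘(ℝ, ℂ) (𝓡 4) ∞ G) (hGJ : IsJHolomorphic (𝓡 4) J G)
    (p : V) (z₁ : ℂ) (hz₁ : z₁ ∈ closure {z : ℂ | ∀ᶠ w in 𝓝 z, G w = p}) :
    ∀ᶠ w in 𝓝 z₁, G w = p := by
  -- notation
  set A : Set ℂ := {z : ℂ | ∀ᶠ w in 𝓝 z, G w = p} with hA_def
  have hAopen : IsOpen A := isOpen_setOf_eventually_nhds
  have hAp : ∀ z ∈ A, G z = p := fun z hz =>
    (show ∀ᶠ w in 𝓝 z, G w = p from hz).self_of_nhds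
  -- `G z₁ = p`
  have hGcont : Continuous G := hG.continuous
  have hGz₁ : G z₁ = p := by
    have hcl : IsClosed {z : ℂ | G z = p} := isClosed_eq hGcont continuous_const
    exact closure_minimal (fun z hz => hAp z hz) hcl hz₁
  -- the chart at `p` and the open set `U₀ = G ⁻¹' source`
  set E := EuclideanSpace ℝ (Fin 4)
  have hsrc_open : IsOpen (chartAt E p).source := (chartAt E p).open_source
  set U₀ : Set ℂ := G ⁻¹' (chartAt E p).source with hU₀
  have hU₀open : IsOpen U₀ := hsrc_open.preimage hGcont
  have hz₁U₀ : z₁ ∈ U₀ := by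
    show G z₁ ∈ (chartAt E p).source
    rw [hGz₁]; exact mem_chart_source E p
  -- the chart expression `u` of `G`
  set u : ℂ → E := (extChartAt (𝓡 4) p) ∘ G with hu_def
  have huC : ∀ z ∈ U₀, ContDiffAt ℝ 2 u z := by
    intro z hz
    have h : ContMDiffAt 𝓘(ℝ, ℂ) 𝓘(ℝ, E) ∞ u z := (contMDiffAt_extChartAt' hz).comp z (hG z)
    exact h.contDiffAt.of_le (WithTop.coe_le_coe.mpr le_top)
  have hu : ContDiffOn ℝ 2 u U₀ := fun z hz => (huC z hz).contDiffWithinAt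
  -- the chart expression `Jt` of `J` along `G`
  set Jt : ℂ → E →L[ℝ] E := fun z =>
    inTangentCoordinates (𝓡 4) (𝓡 4) (id : V → V) id (fun x => J x) p (G z) with hJt_def
  have hJtz₁ : ContDiffAt ℝ 2 Jt z₁ := by
    have h1 : ContMDiffAt (𝓡 4) 𝓘(ℝ, E →L[ℝ] E) ∞
        (inTangentCoordinates (𝓡 4) (𝓡 4) (id : V → V) id (fun x => J x) p) (G z₁) := by
      rw [hGz₁]; exact hJs p
    have h2 : ContMDiffAt 𝓘(ℝ, ℂ) 𝓘(ℝ, E →L[ℝ] E) ∞ Jt z₁ := h1.comp z₁ (hG z₁)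
    exact h2.contDiffAt.of_le (WithTop.coe_le_coe.mpr le_top)
  obtain ⟨U₁, hU₁C, hU₁open, hz₁U₁⟩ :=
    _root_.eventually_nhds_iff.mp (hJtz₁.eventually (by norm_num))
  -- the neighbourhood `U = U₀ ∩ U₁`
  set U : Set ℂ := U₀ ∩ U₁ with hU_def
  have hUopen : IsOpen U := hU₀open.inter hU₁open
  have hz₁U : z₁ ∈ U := ⟨hz₁U₀, hz₁U₁⟩
  have hUnhds : U ∈ 𝓝 z₁ := hUopen.mem_nhds hz₁U
  have hJt : ContDiffOn ℝ 2 Jt U := fun z hz => (hU₁C z hz.2).contDiffWithinAt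
  -- chart identities on `U₀`: `P = D(chart)`, `Q = D(chart⁻¹)`, `Q P = 1 = P Q`, `Jt = P J Q`
  have hsrc : ∀ z ∈ U₀, G z ∈ (extChartAt (𝓡 4) p).source := fun z hz => by
    rwa [extChartAt_source]
  set P : ℂ → E →L[ℝ] E := fun z =>
    (mfderiv (𝓡 4) 𝓘(ℝ, E) (extChartAt (𝓡 4) p) (G z) : E →L[ℝ] E) with hP_def
  set Q : ℂ → E →L[ℝ] E := fun z =>
    (mfderivWithin 𝓘(ℝ, E) (𝓡 4) (extChartAt (𝓡 4) p).symm (range (𝓡 4))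
      (extChartAt (𝓡 4) p (G z)) : E →L[ℝ] E) with hQ_def
  set JE : V → E →L[ℝ] E := fun x => (J x : E →L[ℝ] E) with hJE_def
  have hJ2E : ∀ (x : V) (v : E), JE x (JE x v) = -v := fun x v => hJ2 x v
  have hJt_eq : ∀ z ∈ U₀, ∀ v : E, Jt z v = P z (JE (G z) (Q z v)) := by
    intro z hz v
    have h := inTangentCoordinates_eq_mfderiv_comp (I := 𝓡 4) (I' := 𝓡 4) (f := (id : V → V))
      (g := (id : V → V)) (ϕ := fun x => J x) (x₀ := p) (x := G z) hz hz
    exact DFunLike.congr_fun h v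
  have hQP : ∀ z ∈ U₀, ∀ v : E, Q z (P z v) = v := fun z hz v =>
    DFunLike.congr_fun (mfderivWithin_extChartAt_symm_comp_mfderiv_extChartAt' (I := 𝓡 4)
      (hsrc z hz)) v
  have hPQ : ∀ z ∈ U₀, ∀ v : E, P z (Q z v) = v := fun z hz v =>
    DFunLike.congr_fun (mfderiv_extChartAt_comp_mfderivWithin_extChartAt_symm' (I := 𝓡 4)
      (hsrc z hz)) v
  -- `(Jt z)² = -1` on `U`
  have hJ2' : ∀ z ∈ U, ∀ v, Jt z (Jt z v) = -v := by
    intro z hz v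
    rw [hJt_eq z hz.1, hJt_eq z hz.1, hQP z hz.1, hJ2E, map_neg, hPQ z hz.1]
  -- the `J`-holomorphicity equation in the chart on `U`
  have hDu : ∀ z ∈ U₀, ∀ ζ : ℂ, fderiv ℝ u z ζ = P z (mfderiv 𝓘(ℝ, ℂ) (𝓡 4) G z ζ) := by
    intro z hz ζ
    have h1 := mfderiv_comp z (mdifferentiableAt_extChartAt hz)
      ((hG z).mdifferentiableAt (by norm_num))
    have h2 := DFunLike.congr_fun h1 ζ
    rw [mfderiv_eq_fderiv] at h2
    exact h2
  have hhol : ∀ z ∈ U, fderiv ℝ u z Complex.I = Jt z (fderiv ℝ u z 1) := by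
    intro z hz
    rw [hDu z hz.1 Complex.I, hDu z hz.1 1, hJt_eq z hz.1, hQP z hz.1]
    have h := hGJ z 1
    rw [mul_one] at h
    rw [h]
    rfl
  -- `u = u z₁` on the open set `A ∩ U₀`
  have hAu : ∀ z ∈ A ∩ U₀, u z = u z₁ := by
    intro z hz
    simp only [hu_def, Function.comp_apply, hAp z hz.1, hGz₁]
  have hz₁cl : z₁ ∈ closure (A ∩ U₀) := by
    rw [inter_comm]
    exact mem_closure_iff_nhds.mpr fun t ht => by
      have := mem_closure_iff_nhds.mp hz₁ (U₀ ∩ t) (inter_mem (hU₀open.mem_nhds hz₁U₀) ht)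
      obtain ⟨y, hyUt, hyA⟩ := this
      exact ⟨y, hyUt.2, hyUt.1, hyA⟩
  -- flat unique continuation
  have hflat := eventuallyEq_const_of_jHolomorphicFlat (c := u z₁) hUnhds (hu.mono inter_subset_left)
    hJt hJ2' hhol (hAopen.inter hU₀open) hAu hz₁cl
  -- back to `G` by injectivity of the chart on its source
  filter_upwards [hflat, hU₀open.mem_nhds hz₁U₀] with z hz hzU₀
  have hinj := (extChartAt (𝓡 4) p).injOn (hsrc z hzU₀) (hsrc z₁ hz₁U₀)
  have h' : (extChartAt (𝓡 4) p) (G z) = (extChartAt (𝓡 4) p) (G z₁) := hz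
  rw [← hGz₁]
  exact hinj h'

end JHolomorphicUCP

end Literature.Geometry.Symplectic
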